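import Summits.Langlands.Langlands.Theses.PhantomRMYoshida

/-! ## LOCAL MIRROR of `CrossRegularCurrency.lean` (generated by the planner's `gen_line.py`; byte-identical definitions,
same namespace `…CrossRegular`). It is here ONLY so that this skeleton elaborates before the hub has built the module
`Summits.Langlands.Langlands.Cruxes.ResiduallyYoshidaLifting.CrossRegularCurrency` (published alongside, same directory).
LEAD: as soon as you import any module that imports the currency (e.g. a landed stub lemma), DELETE this mirror block
(from here to the marker `-- END OF LOCAL MIRROR`) and add
`import Summits.Langlands.Langlands.Cruxes.ResiduallyYoshidaLifting.CrossRegularCurrency` at the top; the stub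
signatures are unchanged (they name `…CrossRegular.*` fully qualified), so the registration stays valid. -/

/-!
# Typed currency of the line `cross-regular-annihilator-primes` (crux `ResiduallyYoshidaLifting`, stmt-Langlands-13639)

DEFINITIONS ONLY (no theorem, no sorry). They abbreviate, over existing tree declarations, the recurring
sub-formulae of the stubs in `Lines/cross-regular-annihilator-primes.lean`, so that every registered stub
signature is short and self-contained (`import` this module). Nothing here is new mathematics: `epsBar`,
`DetCond`, `Sh`, `Aut` are VERBATIM the crux's inline `let εb`, determinant clause, `let Sh`, `let Aut`
(definitionally equal: the composition in the Lines file passes the crux's hypotheses to the stubs by `rfl`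
unfolding); `Gen`, `CrossRes`, `CrossCongr`, `CrossType`, `Member`, `HSC`, `ExactCross`, `QGood` are the
line's interface notions (see the docstrings). A prover landing a stub imports this module; should the gate
refuse a `Cruxes` import in a `Theorems/` proposal, re-file this file verbatim as a definition proposal under
`Summits/Langlands/Langlands/Theorems/` (planner note in the line card).

Conventions: `𝒪 = Valued.integer (PadicAlgCl p) = ℤ̄_p`; `q_v = v.residueCard`; arithmetic Frobenius;
`ρ` symplectic with multiplier `ε⁻¹` (cohomological convention of the route), so at an unramified `v` the
eigenvalues pair as `x ↔ q_v⁻¹ x⁻¹` and the ×-shape is `{a, q_v a, b, q_v b}` with `q_v² a b = 1`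
(`a ↔ q_v b`, `q_v a ↔ b`). [cite: Thorne2016, §5.4.4 and Prop. 5.20 (the GL₂ model: St(α_v) at q_v ≡ −1)]
-/

noncomputable section

open scoped Matrix Classical
open Filter

-- `open scoped Classical` is REQUIRED to elaborate `π.1.W` (the place subtypes indexing `mixedSpace ℚ` are
-- `Fintype` classically; cf. `AutomorphicRepsGL`, `UnitaryGroupAutomorphicRep` (H5)).

namespace Summit.Langlands.Langlands.Cruxes.ResiduallyYoshidaLifting.CrossRegular

variable {p : ℕ} [Fact p.Prime] {k : Type} [Field k] [TopologicalSpace k]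

/-- The route's inline mod-`p` cyclotomic character `ε̄ : Γ_ℚ → (ℤ/p)ˣ` (verbatim the crux's `let εb`;
Mathlib `modularCyclotomicCharacter` on `Γ_ℚ`). [folklore] -/
def epsBar (p : ℕ) [Fact p.Prime] : Field.absoluteGaloisGroup ℚ →* (ZMod p)ˣ :=
  (modularCyclotomicCharacter (AlgebraicClosure ℚ)
    (HasEnoughRootsOfUnity.natCard_rootsOfUnity (AlgebraicClosure ℚ) p)).comp
    (MulSemiringAction.toRingAut (Field.absoluteGaloisGroup ℚ) (AlgebraicClosure ℚ))

/-- The crux's determinant clause `det σ̄ = ε̄⁻¹ = det σ̄'` (verbatim). [folklore] -/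
def DetCond (p : ℕ) [Fact p.Prime] {k : Type} [Field k] [CharP k p] [TopologicalSpace k] [DiscreteTopology k]
    (σ σ' : Literature.NumberTheory.GaloisRepresentations.FramedGaloisRep ℚ k 2) : Prop :=
  ∀ g, Literature.NumberTheory.GaloisRepresentations.FramedRep.det σ g = (Units.map (ZMod.castHom (dvd_refl p) k).toMonoidHom (epsBar p g))⁻¹ ∧
    Literature.NumberTheory.GaloisRepresentations.FramedRep.det σ' g = Literature.NumberTheory.GaloisRepresentations.FramedRep.det σ g

/-- The crux's shape clause `Sh r` (verbatim the route's `let Sh`): `r` symplectic with multiplier `ε⁻¹`,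
Greenberg-ordinary of Hodge–Tate shape `(0,0,1,1)` and residually distinguished at `p`, and residually
`σ̄ ⊕ σ̄'` through `red` on almost all Frobenius polynomials. [cite: BoxerEtAl2021, §2 and §7.3 (conventions)] -/
def Sh (σ σ' : Literature.NumberTheory.GaloisRepresentations.FramedGaloisRep ℚ k 2) (red : Valued.integer (PadicAlgCl p) →+* k) (r : Literature.NumberTheory.GaloisRepresentations.FramedGaloisRep ℚ (PadicAlgCl p) 4) : Prop :=
  r.IsSymplecticWithMultiplierFun (fun g => algebraMap ℚ_[p] (PadicAlgCl p)
    ((((Literature.NumberTheory.GaloisRepresentations.GaloisRep.cyclotomicCharacter ℚ p g)⁻¹ : ℤ_[p]ˣ) : ℤ_[p]) : ℚ_[p])) ∧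
  (∀ v : IsDedekindDomain.HeightOneSpectrum (NumberField.RingOfIntegers ℚ), ((p : ℕ) : NumberField.RingOfIntegers ℚ) ∈ v.asIdeal →
    r.IsGreenbergOrdinaryOfShapeAt v ![0, 0, 1, 1] ∧ r.IsResiduallyDistinguishedAt v ![0, 0, 1, 1]) ∧
  (∀ᶠ v : IsDedekindDomain.HeightOneSpectrum (NumberField.RingOfIntegers ℚ) in Filter.cofinite, r.IsUnramifiedAt v ∧ σ.IsUnramifiedAt v ∧ σ'.IsUnramifiedAt v ∧
    ∃ (P : Polynomial (Valued.integer (PadicAlgCl p))) (P₁ P₂ : Polynomial k),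
      r.HasFrobCharpolyAt v (P.map (Valued.integer (PadicAlgCl p)).subtype) ∧
      σ.HasFrobCharpolyAt v P₁ ∧ σ'.HasFrobCharpolyAt v P₂ ∧ P.map red = P₁ * P₂)

/-- The crux's automorphy clause `Aut r` (verbatim the route's `let Aut`): an L-algebraic cuspidal `π` on
`GL₄(𝔸_ℚ)` whose Satake parameters give the arithmetic-Frobenius polynomials of `r` at almost all places.
[cite: BuzzardGeeLMS2014, Conj. 3.2.1 (normalisation)] -/
def Aut (hcpt : Literature.NumberTheory.Automorphic.isCompact_glFiniteIntegralLevel 4 ℚ) (ι : PadicAlgCl p ≃+* ℂ)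
    (r : Literature.NumberTheory.GaloisRepresentations.FramedGaloisRep ℚ (PadicAlgCl p) 4) : Prop :=
  ∃ π : Literature.NumberTheory.Automorphic.CuspidalAutomorphicRepData 4 ℚ hcpt, π.1.IsLAlgebraic ∧ ∀ᶠ v : IsDedekindDomain.HeightOneSpectrum (NumberField.RingOfIntegers ℚ) in Filter.cofinite, ∃ a : Multiset ℂ,
    π.1.HasSatakeParamAt v a ∧ r.IsUnramifiedAt v ∧
      r.HasFrobCharpolyAt v (Literature.NumberTheory.Automorphic.arithFrobPolyOfSatake ι v.residueCard 1 a)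

/-- Residual GENERICITY of a ×-configuration `{a, q a | b, q b}` in `k`: the four eigenvalues are pairwise
distinct and neither residual constituent has an internal ratio `q^{±1}` (`a ≠ q²b`, `b ≠ q²a`); the only
ratio-`q` pairs are the two cross pairs `(a, qa)`, `(b, qb)` (`q² = 1`, i.e. `q ≡ −1`, is allowed: triage
r1-2 sharpen (i)). [cite: Thorne2016, §5.4.4 (two distinct eigenvalues α_v, β_v with α_v/β_v = q_v)] -/
def Gen (q a b : k) : Prop :=
  a ≠ q * a ∧ a ≠ b ∧ a ≠ q * b ∧ q * a ≠ b ∧ q * a ≠ q * b ∧ b ≠ q * b ∧ a ≠ q ^ 2 * b ∧ b ≠ q ^ 2 * a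

/-- CROSS-REGULAR residual Frobenius at `v` in the fixed cross position: `σ̄(Frob_v)` has eigenvalues
`{a, q̄_v b}`, `σ̄'(Frob_v)` has `{q̄_v a, b}`, generic (`Gen`). [cite: Thorne2016, Lemma 5.18 (regularity of ρ̄(Frob_v) is what lets the Steinberg-type condition see the invisible summand)] -/
def CrossRes (σ σ' : Literature.NumberTheory.GaloisRepresentations.FramedGaloisRep ℚ k 2) (v : IsDedekindDomain.HeightOneSpectrum (NumberField.RingOfIntegers ℚ)) (a b : k) : Prop :=
  σ.HasFrobCharpolyAt v ((Polynomial.X - Polynomial.C a) * (Polynomial.X - Polynomial.C ((v.residueCard : k) * b))) ∧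
  σ'.HasFrobCharpolyAt v ((Polynomial.X - Polynomial.C ((v.residueCard : k) * a)) * (Polynomial.X - Polynomial.C b)) ∧
  Gen (v.residueCard : k) a b

/-- ×-CONGRUENCE mod `p^N` of `r(Frob_v)`: its (integral) Frobenius polynomial is congruent coefficientwise
modulo `p^N` in `ℤ̄_p` to `(X−a)(X−q_v a)(X−b)(X−q_v b)` with `q_v² a b = 1` EXACTLY — `r mod p^N` is an
unramified point of the ×-type local deformation problem at `v`. [cite: Thorne2016, Prop. 5.20 ("ρ(Frob_v) agrees modulo p^N with ρ(c)")] -/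
def CrossCongr (N : ℕ) (v : IsDedekindDomain.HeightOneSpectrum (NumberField.RingOfIntegers ℚ)) (r : Literature.NumberTheory.GaloisRepresentations.FramedGaloisRep ℚ (PadicAlgCl p) 4) (a b : Valued.integer (PadicAlgCl p)) : Prop :=
  ∃ P : Polynomial (Valued.integer (PadicAlgCl p)), r.HasFrobCharpolyAt v (P.map (Valued.integer (PadicAlgCl p)).subtype) ∧
    (v.residueCard : Valued.integer (PadicAlgCl p)) ^ 2 * a * b = 1 ∧
    ∀ j : ℕ, ((p : Valued.integer (PadicAlgCl p))) ^ N ∣ (P - (Polynomial.X - Polynomial.C a) * (Polynomial.X - Polynomial.C ((v.residueCard : Valued.integer (PadicAlgCl p)) * a)) *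
      (Polynomial.X - Polynomial.C b) * (Polynomial.X - Polynomial.C ((v.residueCard : Valued.integer (PadicAlgCl p)) * b))).coeff j

/-- ×-TYPE at `v` of a characteristic-0 representation `r` (the local type of a Klingen-new, Roberts–Schmidt
IIIa-type point): inertia at `v` acts unipotently with square-zero monodromy, `(r(τ) − 1)² = 0`, and every
arithmetic Frobenius has characteristic polynomial EXACTLY `(X−a)(X−q_v a)(X−b)(X−q_v b)` with `q_v² a b = 1`
(two mutually paired Lagrangian Jordan blocks). [cite: Thorne2016, §5.4.4 (D_v^St(α_v))] -/
def CrossType (v : IsDedekindDomain.HeightOneSpectrum (NumberField.RingOfIntegers ℚ)) (r : Literature.NumberTheory.GaloisRepresentations.FramedGaloisRep ℚ (PadicAlgCl p) 4) : Prop :=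
  (∀ 𝔓 ∈ v.primesAbove, ∀ τ ∈ 𝔓.inertia (Field.absoluteGaloisGroup ℚ), ((r τ).val - 1) * ((r τ).val - 1) = 0) ∧
  ∃ a b : PadicAlgCl p, (v.residueCard : PadicAlgCl p) ^ 2 * a * b = 1 ∧
    r.HasFrobCharpolyAt v ((Polynomial.X - Polynomial.C a) * (Polynomial.X - Polynomial.C ((v.residueCard : PadicAlgCl p) * a)) * (Polynomial.X - Polynomial.C b) *
      (Polynomial.X - Polynomial.C ((v.residueCard : PadicAlgCl p) * b)))

/-- MEMBER of a Hecke family of level `𝔫` and infinity type `T`: a cuspidal L-algebraic `π` on `GL₄(𝔸_ℚ)`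
with a non-zero `K(𝔫)`-fixed form (principal congruence level, `principalCongruenceLevel`) and infinity type
`T`, together with a Galois representation `r`, irreducible, of the crux's shape `Sh` (same residual pair
`σ̄ ⊕ σ̄'`, ordinary `(0,0,1,1)`), matching `π` at almost all places. [cite: BorelJacquet1979, 4.6 (automorphic representations, level)] -/
def Member (σ σ' : Literature.NumberTheory.GaloisRepresentations.FramedGaloisRep ℚ k 2) (red : Valued.integer (PadicAlgCl p) →+* k)
    {hcpt : Literature.NumberTheory.Automorphic.isCompact_glFiniteIntegralLevel 4 ℚ} (ι : PadicAlgCl p ≃+* ℂ)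
    (𝔫 : Ideal (NumberField.RingOfIntegers ℚ)) (T : Literature.NumberTheory.Automorphic.InfinityType ℚ 4) (π : Literature.NumberTheory.Automorphic.CuspidalAutomorphicRepData 4 ℚ hcpt) (r : Literature.NumberTheory.GaloisRepresentations.FramedGaloisRep ℚ (PadicAlgCl p) 4) : Prop :=
  π.1.IsLAlgebraic ∧ π.1.HasInfinityType T ∧
  (∃ φ ∈ π.1.W, φ ∉ π.1.W' ∧ ∀ u ∈ Literature.NumberTheory.Automorphic.principalCongruenceLevel 4 ℚ 𝔫,
    Literature.NumberTheory.Automorphic.rightTranslation (Literature.NumberTheory.Automorphic.AdelicGroupData.gl 4 ℚ) u φ = φ) ∧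
  r.toGaloisRep.IsIrreducible ∧ Sh σ σ' red r ∧
  (∀ᶠ v : IsDedekindDomain.HeightOneSpectrum (NumberField.RingOfIntegers ℚ) in Filter.cofinite, ∃ a : Multiset ℂ, π.1.HasSatakeParamAt v a ∧ r.IsUnramifiedAt v ∧
    r.HasFrobCharpolyAt v (Literature.NumberTheory.Automorphic.arithFrobPolyOfSatake ι v.residueCard 1 a))

/-- HECKE-SPAN CONGRUENCE mod `p^N` ("`ϱ mod p^N` is an `𝒪/p^N`-point of the anaemic Hecke algebra of the
family `ρf`"): away from a finite set `S`, the `ρf i` and `ϱ` are unramified with integral Frobenius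
polynomials `Pf i v`, `Pr v ∈ ℤ̄_p[X]`, and EVERY `ℤ̄_p`-polynomial relation among the coefficients
`(Pf i v)_j` (in the variables `(v, j)`, `v ∉ S`) that holds for all `i` holds for the `(Pr v)_j` modulo `p^N`.
Equivalently: `T := ℤ̄_p[(coeff tuples)] ⊆ ∏_i ℤ̄_p` admits a ring map `T → ℤ̄_p/p^N` sending each generator to
the corresponding coefficient of `ϱ`. [cite: Thorne2016, Cor. 4.15 (f(T_v) = tr ρ(Frob_v) mod λ^N)] -/
def HSC (N : ℕ) (r : ℕ) (ρf : Fin r → Literature.NumberTheory.GaloisRepresentations.FramedGaloisRep ℚ (PadicAlgCl p) 4) (ϱ : Literature.NumberTheory.GaloisRepresentations.FramedGaloisRep ℚ (PadicAlgCl p) 4) : Prop :=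
  ∃ S : Set (IsDedekindDomain.HeightOneSpectrum (NumberField.RingOfIntegers ℚ)), S.Finite ∧ ∃ (Pf : Fin r → IsDedekindDomain.HeightOneSpectrum (NumberField.RingOfIntegers ℚ) → Polynomial (Valued.integer (PadicAlgCl p))) (Pr : IsDedekindDomain.HeightOneSpectrum (NumberField.RingOfIntegers ℚ) → Polynomial (Valued.integer (PadicAlgCl p))),
    (∀ i, ∀ v ∉ S, (ρf i).IsUnramifiedAt v ∧ (ρf i).HasFrobCharpolyAt v ((Pf i v).map (Valued.integer (PadicAlgCl p)).subtype)) ∧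
    (∀ v ∉ S, ϱ.IsUnramifiedAt v ∧ ϱ.HasFrobCharpolyAt v ((Pr v).map (Valued.integer (PadicAlgCl p)).subtype)) ∧
    ∀ F : MvPolynomial ((IsDedekindDomain.HeightOneSpectrum (NumberField.RingOfIntegers ℚ)) × ℕ) (Valued.integer (PadicAlgCl p)), (∀ m ∈ F.support, ∀ x ∈ m.support, x.1 ∉ S) →
      (∀ i, MvPolynomial.eval (fun x => (Pf i x.1).coeff x.2) F = 0) →
        ((p : Valued.integer (PadicAlgCl p))) ^ N ∣ MvPolynomial.eval (fun x => (Pr x.1).coeff x.2) F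

/-- EXACT CROSS-REGULAR ELEMENT of `im ρ` (the line's coverage hypothesis): some `γ ∈ Γ_ℚ` with
`charpoly ρ(γ) = (X−a)(X−ea)(X−b)(X−eb)`, `e = ε_p(γ)`, `e²ab = 1` in `ℤ̄_p`, in cross position residually
(`σ̄(γ) ∼ {ā, ē b̄}`, `σ̄'(γ) ∼ {ē ā, b̄}`) and residually generic. [cite: Thorne2016, Prop. 5.20 (σ_× replaces complex conjugation c)] -/
def ExactCross (σ σ' : Literature.NumberTheory.GaloisRepresentations.FramedGaloisRep ℚ k 2) (red : Valued.integer (PadicAlgCl p) →+* k) (ρ : Literature.NumberTheory.GaloisRepresentations.FramedGaloisRep ℚ (PadicAlgCl p) 4) : Prop :=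
  ∃ (γ : Field.absoluteGaloisGroup ℚ) (a b e : Valued.integer (PadicAlgCl p)),
    (e : PadicAlgCl p) = algebraMap ℚ_[p] (PadicAlgCl p)
      (((Literature.NumberTheory.GaloisRepresentations.GaloisRep.cyclotomicCharacter ℚ p γ : ℤ_[p]ˣ) : ℤ_[p]) : ℚ_[p]) ∧
    e ^ 2 * a * b = 1 ∧
    (ρ γ).val.charpoly = (Polynomial.X - Polynomial.C (a : PadicAlgCl p)) * (Polynomial.X - Polynomial.C ((e : PadicAlgCl p) * (a : PadicAlgCl p))) *
      (Polynomial.X - Polynomial.C (b : PadicAlgCl p)) * (Polynomial.X - Polynomial.C ((e : PadicAlgCl p) * (b : PadicAlgCl p))) ∧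
    (σ γ).val.charpoly = (Polynomial.X - Polynomial.C (red a)) * (Polynomial.X - Polynomial.C (red e * red b)) ∧
    (σ' γ).val.charpoly = (Polynomial.X - Polynomial.C (red e * red a)) * (Polynomial.X - Polynomial.C (red b)) ∧
    Gen (red e) (red a) (red b)

/-- ADMISSIBLE AUXILIARY PLACE of depth `N` for `ρ` relative to the level `𝔫`: `v ∤ p𝔫`; `ρ`, `σ̄`, `σ̄'`
unramified at `v`; `ρ(Frob_v)` ×-congruent mod `p^N` (`CrossCongr`) with residually cross-regular generic
reduction in the fixed cross position (`CrossRes`). [cite: Thorne2016, Prop. 5.20 and Lemma 5.23] -/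
def QGood (σ σ' : Literature.NumberTheory.GaloisRepresentations.FramedGaloisRep ℚ k 2) (red : Valued.integer (PadicAlgCl p) →+* k) (𝔫 : Ideal (NumberField.RingOfIntegers ℚ))
    (ρ : Literature.NumberTheory.GaloisRepresentations.FramedGaloisRep ℚ (PadicAlgCl p) 4) (N : ℕ) (v : IsDedekindDomain.HeightOneSpectrum (NumberField.RingOfIntegers ℚ)) : Prop :=
  ¬ (v.asIdeal ∣ 𝔫) ∧ ((p : ℕ) : NumberField.RingOfIntegers ℚ) ∉ v.asIdeal ∧ ρ.IsUnramifiedAt v ∧ σ.IsUnramifiedAt v ∧ σ'.IsUnramifiedAt v ∧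
    ∃ a b : Valued.integer (PadicAlgCl p), CrossCongr N v ρ a b ∧ CrossRes σ σ' v (red a) (red b)

/-- RESIDUALLY ADMISSIBLE PLACE for the seed relative to `𝔫₀` and `ρ₀`: `v ∤ p𝔫₀`; `ρ₀`, `σ̄`, `σ̄'` unramified
at `v`; `σ̄ ⊕ σ̄'` cross-regular generic at `v` (`CrossRes`) — the residual level-raising position.
[cite: Sorensen2006, Thm. A (level-raising congruence for GSp₄)] -/
def QGoodRes (σ σ' : Literature.NumberTheory.GaloisRepresentations.FramedGaloisRep ℚ k 2) (𝔫₀ : Ideal (NumberField.RingOfIntegers ℚ)) (ρ₀ : Literature.NumberTheory.GaloisRepresentations.FramedGaloisRep ℚ (PadicAlgCl p) 4) (v : IsDedekindDomain.HeightOneSpectrum (NumberField.RingOfIntegers ℚ)) : Prop :=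
  ¬ (v.asIdeal ∣ 𝔫₀) ∧ ((p : ℕ) : NumberField.RingOfIntegers ℚ) ∉ v.asIdeal ∧ ρ₀.IsUnramifiedAt v ∧ σ.IsUnramifiedAt v ∧ σ'.IsUnramifiedAt v ∧
    ∃ a b : k, CrossRes σ σ' v a b

/-- ×-TYPE HECKE FAMILY of level `𝔫·∏_Q v²` and infinity type `T` at the auxiliary set `Q`, to which `ρ` is
Hecke-span congruent mod `p^N`: finitely many members (`Member`), each of ×-type at every `v ∈ Q`
(`CrossType`), and `HSC N`. [cite: Thorne2016, Thm. 4.14 (the datum (Q, f : T_Q → O/λ^N))] -/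
def CrossFamily (σ σ' : Literature.NumberTheory.GaloisRepresentations.FramedGaloisRep ℚ k 2) (red : Valued.integer (PadicAlgCl p) →+* k)
    (hcpt : Literature.NumberTheory.Automorphic.isCompact_glFiniteIntegralLevel 4 ℚ) (ι : PadicAlgCl p ≃+* ℂ)
    (𝔫 : Ideal (NumberField.RingOfIntegers ℚ)) (T : Literature.NumberTheory.Automorphic.InfinityType ℚ 4) (Q : Finset (IsDedekindDomain.HeightOneSpectrum (NumberField.RingOfIntegers ℚ))) (N : ℕ) (ρ : Literature.NumberTheory.GaloisRepresentations.FramedGaloisRep ℚ (PadicAlgCl p) 4) : Prop :=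
  ∃ (r : ℕ) (πf : Fin r → Literature.NumberTheory.Automorphic.CuspidalAutomorphicRepData 4 ℚ hcpt) (ρf : Fin r → Literature.NumberTheory.GaloisRepresentations.FramedGaloisRep ℚ (PadicAlgCl p) 4),
    (∀ i, Member σ σ' red ι (𝔫 * Q.prod (fun v => v.asIdeal ^ 2)) T (πf i) (ρf i) ∧ ∀ v ∈ Q, CrossType v (ρf i)) ∧
    HSC N r ρf ρ

end Summit.Langlands.Langlands.Cruxes.ResiduallyYoshidaLifting.CrossRegular

end

-- END OF LOCAL MIRROR


/-!
# `ResiduallyYoshidaLifting` (stmt-Langlands-13639, route PhantomRMYoshida) — line `cross-regular-annihilator-primes`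

Crux (fixed, by name): `Summit.Langlands.Langlands.Theses.PhantomRMYoshida.ResiduallyYoshidaLifting` — relative
automorphy lifting at a residually-Yoshida point in weight (2,2): `p` odd; `σ̄, σ̄' : Γ_ℚ → GL₂(k)` odd,
irreducible, non-conjugate, `det = ε̄⁻¹`; `ρ₀, ρ : Γ_ℚ → GL₄(ℚ̄_p)` irreducible, symplectic-`ε⁻¹`,
Greenberg-ordinary `(0,0,1,1)`, `p`-distinguished, residually `σ̄ ⊕ σ̄'`; `Aut ρ₀ → Aut ρ`.

Line (idea card `Ideas/cross-regular-annihilator-primes.md`; triage r1-1/2/3: pass, merged with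
`conjugation-steinberg-primes`): KHARE–THORNE SUCCESSIVE APPROXIMATION WITH CROSS-REGULAR AUXILIARY PRIMES.
The Taylor–Wiles-invisible dual-Selmer block `H¹(ℚ, M(1))`, `M = Hom(σ̄', σ̄)`, is killed by auxiliary primes
`v` at which `ρ̄(Frob_v)` has four distinct eigenvalues `{ā, q̄b̄ | q̄ā, b̄}` with ONE cross ratio `q̄ = q_v`
between the residual constituents (symplecticity forces the second), where the square-zero pure-cross
monodromy defines a smooth, Euler-characteristic-NEUTRAL local condition `𝒟_v^×`. `ρ` is unramified at such
`v`, but `ρ mod p^N` satisfies the condition as soon as `charpoly ρ(Frob_v) ≡ (X−a)(X−q_v a)(X−b)(X−q_v b)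
(mod p^N)`, available at every depth `N` by Chebotarev from ONE exact cross-regular element of `im ρ`
(S1 → S2). Then S3 (level-raising seed from the GIVEN automorphic `ρ₀`) → S4 (integral `R_𝒮(N) = T_𝒮(N)`:
`ρ mod p^N` is Hecke-span congruent to ×-new stable weight-2 forms of level `𝔫₁·Kl(Q_N)`) → S5 (Mazur's
principle mod `p^N` at the auxiliary primes + the limit `N → ∞` at the fixed level `𝔫₁`; Thorne2016
Cor. 4.15) → `Aut ρ`.

Typing policy. The tree has no deformation rings, Selmer groups, Hecke algebras or Siegel modular forms; every
stub is stated at the Galois / `GL₄`-automorphic interface over existing declarations, through the definitions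
of the currency module `CrossRegularCurrency.lean` (same directory; definitions only, no sorry):
`Sh`, `Aut`, `DetCond` (verbatim the crux's inline clauses), `ExactCross`, `QGood`, `QGoodRes`, `CrossType`,
`Member`, `HSC`, `CrossFamily`. Stub signatures are therefore short, `:=`-free and self-contained given
`import Summits.Langlands.Langlands.Cruxes.ResiduallyYoshidaLifting.CrossRegularCurrency` (+ `open scoped
Classical`).

Disproof used (body of `Disproof.lean` not mounted in planner/refuter jails this round; from its evidence
notes): `iff_withoutOdd` — oddness is decoration: no stub takes `σ.IsOdd`; `not_withoutIrreducibleρ_of_witness`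
— `ρ.toGaloisRep.IsIrreducible` is a hypothesis of S1, S4, S5 and is load-bearing in S4 (for `ρ_f ⊕ ρ_g` the
chain S2–S5 would contradict Jacquet–Shalika); `shC_iff_without_residual_unramified` — harmless;
`trace_complexConjugation_eq_zero` — `c` is a DEGENERATE cross element, whence S1 asks for a regular one
(the card's dead variant (α); triage r1-2's kill of the IVa-at-c variant); `iff_congruenceLifting` — the
stubs are indeed a congruence-lifting chain. No `Negative/` lemma has landed for this crux.

References: J. Thorne, *Automorphy of some residually dihedral Galois representations*, Math. Ann. 364 (2016)
[Thorne2016: §1 pp. 3–4, Thm. 4.14, Cor. 4.15, Prop. 4.16, Cor. 5.11, §5.4.4, Lemma 5.18, Prop. 5.20,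
Lemma 5.23]; G. Boxer, F. Calegari, T. Gee, V. Pilloni [BoxerEtAl2021 §7]; F. Calegari, D. Geraghty
[CalegariGeraghty2017]; C. Sorensen [Sorensen2006]; H. Wang [WangHaining2022LevelRaising]; P. van Hoften,
arXiv:1906.04008; T. Gee, O. Taïbi [GeeTaibi2019]; M. Kisin [Kisin2009]; A. Borel, H. Jacquet
[BorelJacquet1979, 4.3 (i), 4.6].
-/

noncomputable section

open scoped Matrix Classical
open Filter Set Function

-- `open scoped Classical` is REQUIRED (see the currency module).

namespace Summit.Langlands.Langlands.Cruxes.ResiduallyYoshidaLifting.CrossRegularAnnihilatorPrimes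

/-! ## Stubs of the line (registered on stmt-Langlands-13639) -/

/-- STUB S1 — COVERAGE STUB (exact cross-regular element, `Summit.Langlands.Langlands.Cruxes.ResiduallyYoshidaLifting.CrossRegular.ExactCross`). For the crux data —
`σ̄, σ̄'` irreducible, non-conjugate, `det = ε̄⁻¹`, and `ρ` irreducible of shape `Sh` (symplectic-`ε⁻¹`,
Greenberg `(0,0,1,1)`, residually `σ̄ ⊕ σ̄'`) — there is `γ ∈ Γ_ℚ` at which `ρ(γ)` is EXACTLY ×-shaped,
`charpoly ρ(γ) = (X−a)(X−ea)(X−b)(X−eb)`, `e = ε_p(γ)`, `e²ab = 1`, in CROSS position residually (`ā, ē b̄` are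
the eigenvalues of `σ̄(γ)`, `ē ā, b̄` those of `σ̄'(γ)`) and residually GENERIC. Seed: complex conjugation
`c` is an exact but DEGENERATE cross element of every odd symplectic `ρ` (Disproof
`trace_complexConjugation_eq_zero`: tr ρ(c) = 0); for `im ρ ⊇ Γ(p)` a residual cross-regular generic class
Hensel-lifts to an exact one along the block-diagonal torus (one equation `ν b' = a`, transversal).
EXPECTED TO FAIL exactly on the sub-sector no surviving line covers: `p = 3` phantom-RM pairs have no
cross-regular residual class at all (triage r1-1, `cross_regular.py`, exhaustive), and very small / deep
images may obstruct the Hensel step. This is precisely the hypothesis the route planner is asked to add to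
the crux (triage r1-1/2/3 "sharpen"); once added, S1 is discharged by `id` and the line has four stubs.
[cite: Thorne2016, Prop. 5.20 and Lemma 5.23 (c ∈ G_K replaced by a regular exact cross element σ_×)] -/
theorem stub_exactCrossElement :
    ∀ (p : ℕ) [Fact p.Prime], p ≠ 2 → ∀ (k : Type) [Field k] [CharP k p] [IsAlgClosed k] [TopologicalSpace k] [DiscreteTopology k] (red : Valued.integer (PadicAlgCl p) →+* k) (σ σ' : Literature.NumberTheory.GaloisRepresentations.FramedGaloisRep ℚ k 2) (hcpt : Literature.NumberTheory.Automorphic.isCompact_glFiniteIntegralLevel 4 ℚ) (ι : PadicAlgCl p ≃+* ℂ) (ρ : Literature.NumberTheory.GaloisRepresentations.FramedGaloisRep ℚ (PadicAlgCl p) 4), σ.toGaloisRep.IsIrreducible → σ'.toGaloisRep.IsIrreducible → Summit.Langlands.Langlands.Cruxes.ResiduallyYoshidaLifting.CrossRegular.DetCond p σ σ' → (¬ ∃ g : GL (Fin 2) k, ∀ x, g * σ x * g⁻¹ = σ' x) → ρ.toGaloisRep.IsIrreducible → Summit.Langlands.Langlands.Cruxes.ResiduallyYoshidaLifting.CrossRegular.Sh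 σ σ' red ρ → Summit.Langlands.Langlands.Cruxes.ResiduallyYoshidaLifting.CrossRegular.ExactCross σ σ' red ρ := by
  sorry

/-- STUB S2 (Chebotarev supply of cross-regular auxiliary primes at every depth). From an exact cross-regular
element `γ` (S1): for every non-zero ideal `𝔫`, every `m` and every `N` there is a set `Q` of at least `m`
finite places `v ∤ p𝔫` at which `ρ, ρ₀, σ̄, σ̄'` are unramified, `ρ̄(Frob_v)` is cross-regular generic in the
SAME cross position, and `charpoly ρ(Frob_v) ≡ (X−a)(X−q_v a)(X−b)(X−q_v b) (mod p^N)` with `q_v² a b = 1`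
EXACTLY in `ℤ̄_p` (`Summit.Langlands.Langlands.Cruxes.ResiduallyYoshidaLifting.CrossRegular.QGood`) — `ρ mod p^N` is an unramified point of the ×-type local condition at
`v` while `ρ` is not (purity). Proof: Frobenii are dense in `Γ_ℚ` (Chebotarev: tree `chebotarev_artinRep_holds`,
`GammaS.dense_frob`); `ρ(g) ≡ ρ(γ) (mod p^N)`, `σ̄(g) ∼ σ̄(γ)`, `σ̄'(g) ∼ σ̄'(γ)`, `ε(g) ≡ ε(γ)` cut out an open
neighbourhood of `γ` (finite image of `σ̄, σ̄'`, continuity of `ρ`); for `Frob_v` in it put `a := a_γ`,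
`b := (q_v² a)⁻¹`; `ρ, ρ₀, σ̄, σ̄'` are unramified almost everywhere by `Sh` (finitely many exclusions).
[cite: Thorne2016, Lemma 5.23 and proof of Prop. 5.20] -/
theorem stub_crossRegularSupply :
    ∀ (p : ℕ) [Fact p.Prime], p ≠ 2 → ∀ (k : Type) [Field k] [CharP k p] [IsAlgClosed k] [TopologicalSpace k] [DiscreteTopology k] (red : Valued.integer (PadicAlgCl p) →+* k) (σ σ' : Literature.NumberTheory.GaloisRepresentations.FramedGaloisRep ℚ k 2) (hcpt : Literature.NumberTheory.Automorphic.isCompact_glFiniteIntegralLevel 4 ℚ) (ι : PadicAlgCl p ≃+* ℂ) (ρ₀ ρ : Literature.NumberTheory.GaloisRepresentations.FramedGaloisRep ℚ (PadicAlgCl p) 4), Summit.Langlands.Langlands.Cruxes.ResiduallyYoshidaLifting.CrossRegular.Sh σ σ' red ρ₀ → Summit.Langlands.Langlands.Cruxes.ResiduallyYoshidaLifting.CrossRegular.Sh σ σ' red ρ → Summit.Langlands.Langlands.Cruxes.ResiduallyYoshidaLifting.CrossRegular.ExactCross σ σ' red ρ → ∀ (𝔫 : Ideal (NumberField.RingOfIntegers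 ℚ)), 𝔫 ≠ 0 → ∀ (m N : ℕ), ∃ Q : Finset (IsDedekindDomain.HeightOneSpectrum (NumberField.RingOfIntegers ℚ)), m ≤ Q.card ∧ ∀ v ∈ Q, ρ₀.IsUnramifiedAt v ∧ Summit.Langlands.Langlands.Cruxes.ResiduallyYoshidaLifting.CrossRegular.QGood σ σ' red 𝔫 ρ N v := by
  sorry

/-- STUB S3 (level-raising seed: a STABLE weight-2 automorphic point of ×-type at the auxiliary primes). From the
automorphic, irreducible `ρ₀` of shape `Sh` (the crux's relative hypothesis — used here and only here): there
are a base level `𝔫₀ ≠ 0` and an infinity type `T₀` such that for every finite set `Q` of places `v ∤ p𝔫₀` at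
which `ρ₀` is unramified and `σ̄ ⊕ σ̄'` is cross-regular generic (`Summit.Langlands.Langlands.Cruxes.ResiduallyYoshidaLifting.CrossRegular.QGoodRes`), there is a cuspidal
L-algebraic `π₁` of `GL₄(𝔸_ℚ)` with a `K(𝔫₀·∏_Q v²)`-fixed vector and infinity type `T₀`, whose Galois
representation `ρ₁` is irreducible, of shape `Sh`, and of ×-TYPE at each `v ∈ Q` (`Summit.Langlands.Langlands.Cruxes.ResiduallyYoshidaLifting.CrossRegular.CrossType`:
`(ρ₁(τ) − 1)² = 0` on inertia, exact Frobenius shape `(X−a)(X−q_v a)(X−b)(X−q_v b)`, `q_v² ab = 1`; on GSp₄: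
Klingen-new of Roberts–Schmidt type IIIa). `Q = ∅` is `ρ₀` itself with its level and infinity type. Engine:
level raising for GSp₄ at a CROSS level-raising congruence (Sorensen2006 / WangHaining2022LevelRaising in
regular weight; weight (2,2) through the ordinary family + BoxerEtAl2021 classicality), GeeTaibi2019
transfer. OPEN in weight 2 (triage r1-2 (iii)); stable → stable, NOT the endoscopic → stable raising of crux 3.
[cite: Sorensen2006, Thm. A] [cite: Thorne2016, §4.8 (the level-raising step of the Khare–Thorne method)] -/
theorem stub_crossLevelRaisingSeed :
    ∀ (p : ℕ) [Fact p.Prime], p ≠ 2 → ∀ (k : Type) [Field k] [CharP k p] [IsAlgClosed k] [TopologicalSpace k] [DiscreteTopology k] (red : Valued.integer (PadicAlgCl p) →+* k) (σ σ' : Literature.NumberTheory.GaloisRepresentations.FramedGaloisRep ℚ k 2) (hcpt : Literature.NumberTheory.Automorphic.isCompact_glFiniteIntegralLevel 4 ℚ) (ι : PadicAlgCl p ≃+* ℂ) (ρ₀ : Literature.NumberTheory.GaloisRepresentations.FramedGaloisRep ℚ (PadicAlgCl p) 4), σ.toGaloisRep.IsIrreducible → σ'.toGaloisRep.IsIrreducible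 → Summit.Langlands.Langlands.Cruxes.ResiduallyYoshidaLifting.CrossRegular.DetCond p σ σ' → (¬ ∃ g : GL (Fin 2) k, ∀ x, g * σ x * g⁻¹ = σ' x) → ρ₀.toGaloisRep.IsIrreducible → Summit.Langlands.Langlands.Cruxes.ResiduallyYoshidaLifting.CrossRegular.Sh σ σ' red ρ₀ → Summit.Langlands.Langlands.Cruxes.ResiduallyYoshidaLifting.CrossRegular.Aut hcpt ι ρ₀ → ∃ (𝔫₀ : Ideal (NumberField.RingOfIntegers ℚ)) (T₀ : Literature.NumberTheory.Automorphic.InfinityType ℚ 4), 𝔫₀ ≠ 0 ∧ ∀ Q : Finset (IsDedekindDomain.HeightOneSpectrum (NumberField.RingOfIntegers ℚ)), (∀ v ∈ Q, Summit.Langlands.Langlands.Cruxes.ResiduallyYoshidaLifting.CrossRegular.QGoodRes σ σ' 𝔫₀ ρ₀ v) → ∃ (π₁ : Literature.NumberTheory.Automorphic.CuspidalAutomorphicRepData 4 ℚ hcpt) (ρ₁ : Literature.NumberTheory.GaloisRepresentations.FramedGaloisRep ℚ (PadicAlgCl p) 4), Summit.Langlands.Langlands.Cruxes.ResiduallyYoshidaLifting.CrossRegular.Member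 σ σ' red ι (𝔫₀ * Q.prod (fun v => v.asIdeal ^ 2)) T₀ π₁ ρ₁ ∧ ∀ v ∈ Q, Summit.Langlands.Langlands.Cruxes.ResiduallyYoshidaLifting.CrossRegular.CrossType v ρ₁ := by
  sorry

/-- STUB S4 — THE LEVER, HARDEST (integral `R_𝒮(N) = T_𝒮(N)` with the ×-type condition at the auxiliary primes, in
weight (2,2), read as a Hecke-span congruence `Summit.Langlands.Langlands.Cruxes.ResiduallyYoshidaLifting.CrossRegular.HSC`). For `ρ` irreducible of shape `Sh` there are a level
`𝔫₁ ≠ 0` and an infinity type `T₁` such that for every `N` and every set `Q`, `#Q ≥ 2`, of admissible places of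
depth `N` (`Summit.Langlands.Langlands.Cruxes.ResiduallyYoshidaLifting.CrossRegular.QGood`: `v ∤ p𝔫₁`, `ρ` unramified, `ρ̄(Frob_v)` cross-regular generic, `ρ(Frob_v)` ×-congruent mod
`p^N`): IF a stable automorphic ×-type point with the same residual pair exists at the primes of `Q` (S3's
seed, any base level prime to `Q`), THEN `ρ mod p^N` is an `𝒪/p^N`-point of the ×-new weight-2 Hecke algebra
of level `𝔫₁·Kl(Q)`: a finite family of cuspidal L-algebraic `GL₄` representations of level `K(𝔫₁∏_Q v²)`, type
`T₁`, with irreducible Galois representations of shape `Sh` and ×-type at `Q`, to which `ρ` is Hecke-span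
congruent mod `p^N` (`Summit.Langlands.Langlands.Cruxes.ResiduallyYoshidaLifting.CrossRegular.CrossFamily`). Inside (the card's lever): `ad⁰ρ̄ = ad⁰σ̄ ⊕ ad⁰σ̄' ⊕ M`; the ×-type
local condition `𝒟_v^×` is Weil–Deligne-admissible (`cross ∈ 𝔰𝔭₄`, `cross² = 0`: triage r1-1 Scratch.lean,
proved), formally smooth and NEUTRAL (`dim L_v = 2 = h⁰(ℚ_v, ad⁰ρ̄)`), and `L_v^⊥` kills the
Taylor–Wiles-invisible classes of `H¹(ℚ, M(1))` seen by `Frob_v` (Thorne2016 Lemma 5.18 / Prop. 5.20 with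
`St(α_v) ↦ 𝒟^×`, `M₁(1) ↦ M(1)`); reducible ×-type deformations are unramified at `v` with the exact cross
congruence, so with `#Q ≥ 2` the Yoshida locus is no component; ordinary Taylor–Wiles primes for
`ad⁰σ̄(1) ⊕ ad⁰σ̄'(1)`; Calegari–Geraghty / BoxerEtAl2021 §7 patching of the weight-(2,2) higher-Hida 2-term
complexes (ℓ₀ = 1) with `R_∞` REGULAR (all local conditions smooth — triage r1-2 (ii)), which is what makes the
statement INTEGRAL; solvable base change / Ihara avoidance to move the seed onto `ρ`'s local components.
Honours `not_withoutIrreducibleρ_of_witness`: `ρ` irreducible is a hypothesis (for `ρ_f ⊕ ρ_g` this stub with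
S2, S5 would contradict Jacquet–Shalika). [cite: Thorne2016, Cor. 5.11, Prop. 5.20, §6]
[cite: BoxerEtAl2021, §7] [cite: Kisin2009, (framed patching)] [cite: CalegariGeraghty2017, (ℓ₀ = 1)] -/
theorem stub_crossTypePatching :
    ∀ (p : ℕ) [Fact p.Prime], p ≠ 2 → ∀ (k : Type) [Field k] [CharP k p] [IsAlgClosed k] [TopologicalSpace k] [DiscreteTopology k] (red : Valued.integer (PadicAlgCl p) →+* k) (σ σ' : Literature.NumberTheory.GaloisRepresentations.FramedGaloisRep ℚ k 2) (hcpt : Literature.NumberTheory.Automorphic.isCompact_glFiniteIntegralLevel 4 ℚ) (ι : PadicAlgCl p ≃+* ℂ) (ρ : Literature.NumberTheory.GaloisRepresentations.FramedGaloisRep ℚ (PadicAlgCl p) 4), σ.toGaloisRep.IsIrreducible → σ'.toGaloisRep.IsIrreducible → Summit.Langlands.Langlands.Cruxes.ResiduallyYoshidaLifting.CrossRegular.DetCond p σ σ' → (¬ ∃ g : GL (Fin 2) k, ∀ x, g * σ x * g⁻¹ = σ' x) → ρ.toGaloisRep.IsIrreducible → Summit.Langlands.Langlands.Cruxes.ResiduallyYoshidaLifting.CrossRegular.Sh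 σ σ' red ρ → ∃ (𝔫₁ : Ideal (NumberField.RingOfIntegers ℚ)) (T₁ : Literature.NumberTheory.Automorphic.InfinityType ℚ 4), 𝔫₁ ≠ 0 ∧ ∀ (N : ℕ) (Q : Finset (IsDedekindDomain.HeightOneSpectrum (NumberField.RingOfIntegers ℚ))), (∀ v ∈ Q, Summit.Langlands.Langlands.Cruxes.ResiduallyYoshidaLifting.CrossRegular.QGood σ σ' red 𝔫₁ ρ N v) → 2 ≤ Q.card → (∃ (𝔫₀ : Ideal (NumberField.RingOfIntegers ℚ)) (T₀ : Literature.NumberTheory.Automorphic.InfinityType ℚ 4) (π₁ : Literature.NumberTheory.Automorphic.CuspidalAutomorphicRepData 4 ℚ hcpt) (ρ₁ : Literature.NumberTheory.GaloisRepresentations.FramedGaloisRep ℚ (PadicAlgCl p) 4), 𝔫₀ ≠ 0 ∧ (∀ v ∈ Q, ¬ (v.asIdeal ∣ 𝔫₀)) ∧ Summit.Langlands.Langlands.Cruxes.ResiduallyYoshidaLifting.CrossRegular.Member σ σ' red ι (𝔫₀ * Q.prod (fun v => v.asIdeal ^ 2)) T₀ π₁ ρ₁ ∧ ∀ v ∈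 Q, Summit.Langlands.Langlands.Cruxes.ResiduallyYoshidaLifting.CrossRegular.CrossType v ρ₁) → Summit.Langlands.Langlands.Cruxes.ResiduallyYoshidaLifting.CrossRegular.CrossFamily σ σ' red hcpt ι 𝔫₁ T₁ Q N ρ := by
  sorry

/-- STUB S5 (automorphy by successive approximation = Mazur's principle mod `p^N` at the ×/Klingen primes + the
limit; Thorne2016 Cor. 4.15 transplanted). If for EVERY `N` there are admissible auxiliary places `Q_N` of depth
`N` (`Summit.Langlands.Langlands.Cruxes.ResiduallyYoshidaLifting.CrossRegular.QGood`) and a ×-type family of level `K(𝔫₁∏_{Q_N} v²)` and fixed infinity type `T₁` to which `ρ` is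
Hecke-span congruent mod `p^N` (`Summit.Langlands.Langlands.Cruxes.ResiduallyYoshidaLifting.CrossRegular.CrossFamily`), then `Aut ρ`. Inside: (a) LEVEL LOWERING mod `p^N` at
`v ∈ Q_N` for a residually-Yoshida `𝔪` — `ρ mod p^N` is unramified at `v` with four distinct residual Frobenius
eigenvalues (the hypothesis of every Mazur principle in print: Thorne2016 Thm. 4.14 / Prop. 4.16; van Hoften
arXiv:1906.04008 Thm. 1.2 for GSp₄) — realised in a regular weight of the GSp₄ Hida family (étale `H³`,
vanishing cycles at Klingen level) and specialised back to (2,2), or by a coherent analogue;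
Boston–Lenstra–Ribet is unavailable (`ρ̄` reducible) and is to be replaced by a GMA / multiplicity argument at
`𝔪` (triage r1-3) — the OPEN automorphic input where `NonRegularWeightBarrier` bites; (b) the LIMIT: the
`𝒪/p^N`-eigensystems of the finite `𝒪`-algebra `T_𝔪(𝔫₁)` (Harish-Chandra finiteness, tree
`harishChandra_finiteness_gl`) are compatible, give `T_𝔪(𝔫₁) → 𝒪`, hence a weight-2 ordinary eigenform with
the Frobenius polynomials of `ρ` (finitely many eigensystems are `p`-adically separated on a set of places of
positive density: Chebotarev + continuity), stable since `ρ` is irreducible, classical by BoxerEtAl2021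
(`p`-distinguished), transferred to a cuspidal `π` on `GL₄` (GeeTaibi2019). [cite: Thorne2016, Cor. 4.15 and Thm. 4.14]
[cite: BorelJacquet1979, 4.3 (i) (Harish-Chandra finiteness)] -/
theorem stub_successiveApproximation :
    ∀ (p : ℕ) [Fact p.Prime], p ≠ 2 → ∀ (k : Type) [Field k] [CharP k p] [IsAlgClosed k] [TopologicalSpace k] [DiscreteTopology k] (red : Valued.integer (PadicAlgCl p) →+* k) (σ σ' : Literature.NumberTheory.GaloisRepresentations.FramedGaloisRep ℚ k 2) (hcpt : Literature.NumberTheory.Automorphic.isCompact_glFiniteIntegralLevel 4 ℚ) (ι : PadicAlgCl p ≃+* ℂ) (ρ : Literature.NumberTheory.GaloisRepresentations.FramedGaloisRep ℚ (PadicAlgCl p) 4), σ.toGaloisRep.IsIrreducible → σ'.toGaloisRep.IsIrreducible → Summit.Langlands.Langlands.Cruxes.ResiduallyYoshidaLifting.CrossRegular.DetCond p σ σ' → (¬ ∃ g : GL (Fin 2) k, ∀ x, g * σ x * g⁻¹ = σ' x) → ρ.toGaloisRep.IsIrreducible → Summit.Langlands.Langlands.Cruxes.ResiduallyYoshidaLifting.CrossRegular.Sh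 σ σ' red ρ → ∀ (𝔫₁ : Ideal (NumberField.RingOfIntegers ℚ)) (T₁ : Literature.NumberTheory.Automorphic.InfinityType ℚ 4), 𝔫₁ ≠ 0 → (∀ N : ℕ, ∃ Q : Finset (IsDedekindDomain.HeightOneSpectrum (NumberField.RingOfIntegers ℚ)), (∀ v ∈ Q, Summit.Langlands.Langlands.Cruxes.ResiduallyYoshidaLifting.CrossRegular.QGood σ σ' red 𝔫₁ ρ N v) ∧ Summit.Langlands.Langlands.Cruxes.ResiduallyYoshidaLifting.CrossRegular.CrossFamily σ σ' red hcpt ι 𝔫₁ T₁ Q N ρ) → Summit.Langlands.Langlands.Cruxes.ResiduallyYoshidaLifting.CrossRegular.Aut hcpt ι ρ := by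
  sorry


/-! ## Composition: the stubs imply the crux

Pure logic over the five stubs: S1 gives the exact cross-regular element; S3 (applied to `ρ₀`) a base level
`𝔫₀` and type `T₀` with ×-type seeds at every residually admissible `Q`; S4 (applied to `ρ`) a level `𝔫₁` and
type `T₁`; for each depth `N`, S2 (avoiding `𝔫₀𝔫₁`, `#Q ≥ 2`) supplies `Q_N`, S3 the seed at `Q_N`, S4 the
×-family with `HSC N`; S5 concludes `Aut ρ`. The crux's inline `let εb / Aut / Sh` clauses are passed to the
currency's `DetCond / Aut / Sh` by definitional unfolding; the only lemmas used are `mul_ne_zero`,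
`dvd_mul_of_dvd_left`, `dvd_mul_of_dvd_right`. -/

/-- **The crux `ResiduallyYoshidaLifting` from the stubs of line `cross-regular-annihilator-primes`.**
[cite: Thorne2016, Cor. 4.15 (architecture of the argument)] -/
theorem ResiduallyYoshidaLifting_of :
    Summit.Langlands.Langlands.Theses.PhantomRMYoshida.ResiduallyYoshidaLifting := by
  intro p _ hp k _ _ _ _ _ red σ σ' hcpt ι ρ₀ ρ εb Aut Sh hodd hodd' hirr hirr' hdet hnc hirr₀ hSh₀ hAut₀ hirrρ hShρ
  -- S1: an exact cross-regular element in `im ρ`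
  have hX := stub_exactCrossElement p hp k red σ σ' hcpt ι ρ hirr hirr' hdet hnc hirrρ hShρ
  -- S3: base level / infinity type of the seed and ×-type level raising of `ρ₀`
  obtain ⟨𝔫₀, T₀, h𝔫₀, hseed⟩ :=
    stub_crossLevelRaisingSeed p hp k red σ σ' hcpt ι ρ₀ hirr hirr' hdet hnc hirr₀ hSh₀ hAut₀
  -- S4: level / infinity type of the ×-families and the patching statement for `ρ`
  obtain ⟨𝔫₁, T₁, h𝔫₁, hpatch⟩ := stub_crossTypePatching p hp k red σ σ' hcpt ι ρ hirr hirr' hdet hnc hirrρ hShρ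
  -- S5: successive approximation at level `𝔫₁`
  refine stub_successiveApproximation p hp k red σ σ' hcpt ι ρ hirr hirr' hdet hnc hirrρ hShρ 𝔫₁ T₁ h𝔫₁ ?_
  intro N
  -- S2: auxiliary primes of depth `N`, prime to `𝔫₀ 𝔫₁`, at least two of them
  obtain ⟨Q, hcard, hQ⟩ := stub_crossRegularSupply p hp k red σ σ' hcpt ι ρ₀ ρ hSh₀ hShρ hX (𝔫₀ * 𝔫₁)
    (mul_ne_zero h𝔫₀ h𝔫₁) 2 N
  refine ⟨Q, fun v hv => ?_, ?_⟩
  · -- admissibility of `v ∈ Q` relative to `𝔫₁` (for S4 / S5)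
    obtain ⟨hρ₀v, hdvd, hvp, hρv, hσv, hσ'v, a, b, hcongr, hres⟩ := hQ v hv
    exact ⟨fun h1 => hdvd (dvd_mul_of_dvd_right h1 𝔫₀), hvp, hρv, hσv, hσ'v, a, b, hcongr, hres⟩
  · -- the seed at `Q` (S3), then the ×-family with `HSC N` (S4)
    obtain ⟨π₁, ρ₁, hmem, hx₁⟩ := hseed Q (fun v hv => by
      obtain ⟨hρ₀v, hdvd, hvp, hρv, hσv, hσ'v, a, b, hcongr, hres⟩ := hQ v hv
      exact ⟨fun h0 => hdvd (dvd_mul_of_dvd_left h0 𝔫₁), hvp, hρ₀v, hσv, hσ'v, red a, red b, hres⟩)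
    exact hpatch N Q (fun v hv => by
      obtain ⟨hρ₀v, hdvd, hvp, hρv, hσv, hσ'v, a, b, hcongr, hres⟩ := hQ v hv
      exact ⟨fun h1 => hdvd (dvd_mul_of_dvd_right h1 𝔫₀), hvp, hρv, hσv, hσ'v, a, b, hcongr, hres⟩) hcard
      ⟨𝔫₀, T₀, π₁, ρ₁, h𝔫₀, fun v hv => fun h0 => (hQ v hv).2.1 (dvd_mul_of_dvd_left h0 𝔫₁), hmem, hx₁⟩

end Summit.Langlands.Langlands.Cruxes.ResiduallyYoshidaLifting.CrossRegularAnnihilatorPrimes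

end
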